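import Literature.AlgebraicGeometry.Frobenioids.UnitTrivializationBirat
import Literature.AlgebraicGeometry.Frobenioids.DivisorMonoidBirationalTypesProofs
import Literature.AlgebraicGeometry.Frobenioids.BiratUnits
import Literature.AlgebraicGeometry.Frobenioids.BirationalizationBiratData
import HarnessLib

/-!
# Frobenioids I, Prop. 4.8 (iii): transfer of Frobenius-compact objects from `(C^un-tr)^birat` to
# `(C^istr)^birat`

Mochizuki, *The geometry of Frobenioids I: the general theory*, Kyushu J. Math. **62** (2008)
293–400, Def. 1.2 (iv) p. 23 (Frobenius-compact objects), Def. 1.3 (iii)(c) p. 24, Def. 3.1 (i)(b)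
p. 56, Def. 4.5 (iii)(b) p. 86, Prop. 4.8 (iii) p. 88 ("assertion (iii) follows formally from the
definitions"). [cite: MochizukiFrdI2008, Prop. 4.8 (iii) p.88]

Proof-only. The hypothesis (b) of Def. 4.5 (iii) is «`(C^un-tr)^birat` admits a Frobenius-compact
object»; the standard-type clause Def. 3.1 (i)(b) needed for `(C^istr)^birat` in Prop. 4.8 (iii) is a
Frobenius-compact object of `(C^istr)^birat` (the recorded residual of seat abc-iut-L6-t20's
`prop48iii_of_frobeniusCompact`). This file proves the transfer along the full comparison functor
`toUntrBirat : (C^istr)^birat → (C^un-tr)^birat` (seat abc-iut-L1-d5):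
* `endSubmonoid_comm_of_isOfIsotropicType` — in a Frobenioid of isotropic type `O^▷(A)` is commutative
  (Def. 1.3 (iii)(c): the transport of `O^▷(A)` along the co-angular pre-step `β ∈ O^▷(A)` depends only
  on `Base(β) = Base(id)`, hence is the identity), so `O^×(A)` is commutative;
* `frobeniusCompact_core` — the group-theoretic heart: along a homomorphism `π` carrying the units
  `U₁` ONTO the units `U₂`, the two clauses (some unit is non-torsion; an automorphism acting on the
  perfection of the units by `λ ∈ ℚ_{>0}` acts trivially) ascend from `U₂` to `U₁` (a non-torsion unit
  downstairs on which the action is both `λ` and trivial forces `λ = 1`);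
* `isFrobeniusCompact_of_toUntrBirat_of_comm` — the transfer given commutativity of `O^×` upstairs
  (unconditional); `isFrobeniusCompact_of_toUntrBirat`, `exists_isFrobeniusCompact_istrBirat` — the
  transfer, CONDITIONAL on Prop. 4.4 (ii) for `C^istr` («`(C^istr)^birat → F_{0_D}` is a Frobenioid», taken as the hypothesis
  `hB : IsFrobenioid (Birat.toElemZero (isFrobenioid_istr hF) hsq')`, used only for the commutativity
  of `O^×`; its discharge is the «`C^birat` is a Frobenioid» row of seat abc-iut-L6-t8).
No statement of the paper is strengthened; nothing here bears on [IUTchIII] Cor. 3.12.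
-/

namespace Literature.AlgebraicGeometry.Frobenioids

open CategoryTheory Opposite

universe w v v' u u'

namespace PreFrobenioid

variable {D : Type u} [Category.{v} D] {Φ : Dᵒᵖ ⥤ CommMonCat.{w}}
  {C : Type u'} [Category.{v'} C] {F : C ⥤ ElemFrobenioid Φ}

open PreFrobenioidData (ofFunctor)

/-! ### `O^▷` and `O^×` are commutative in a Frobenioid of isotropic type -/

/-- In a Frobenioid of isotropic type, `O^▷(A)` is commutative: for `α, β ∈ O^▷(A)`, `β` is a co-angular
pre-step with `Base(β) = Base(id_A)`, so the transport `O^▷(A) ⥲ O^▷(A)` along `β` of Def. 1.3 (iii)(c)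
coincides with the one along `id_A`, i.e. `β ∘ α = α ∘ β`. [cite: MochizukiFrdI2008, Def. 1.3 (iii) p.24] -/
theorem endSubmonoid_comm_of_isOfIsotropicType (hF : IsFrobenioid F) (hiso : IsOfIsotropicType F) (A : C)
    (α β : End A) (hα : α ∈ endSubmonoid F A) (hβ : β ∈ endSubmonoid F A) :
    (show A ⟶ A from α) ≫ (show A ⟶ A from β) = (show A ⟶ A from β) ≫ (show A ⟶ A from α) := by
  have hβiso : IsIso (Base F (show A ⟶ A from β)) := by
    rw [show Base F (show A ⟶ A from β) = 𝟙 _ from hβ.1]; infer_instance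
  have hβc : IsCoAngularPreStep F (show A ⟶ A from β) :=
    ⟨isCoAngular_of_isIsotropic_src hF _ (hiso A), hβ.2, hβiso⟩
  have h1 : IsCoAngularPreStep F (𝟙 A) := isCoAngularPreStep_id hF A
  have hb : Base F (show A ⟶ A from β) = Base F (𝟙 A) := hβ.1.trans (base_id F A).symm
  obtain ⟨e, he⟩ := hF.iii_c (show A ⟶ A from β) hβc
  have key : e ⟨α, hα⟩ = ⟨α, hα⟩ :=
    hF.iii_c_base (show A ⟶ A from β) (𝟙 A) hβc h1 hb ⟨α, hα⟩ (e ⟨α, hα⟩) ⟨α, hα⟩ (he ⟨α, hα⟩)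
      (by rw [Category.id_comp, Category.comp_id])
  have h := he ⟨α, hα⟩
  rw [key] at h
  exact h.symm

/-- Hence `O^×(A)` is commutative in a Frobenioid of isotropic type (the first clause of
Frobenius-compactness, Def. 1.2 (iv), holds for every object). [cite: MochizukiFrdI2008, Def. 1.2 (iv) p.23] -/
theorem unitsSubgroup_comm_of_isOfIsotropicType (hF : IsFrobenioid F) (hiso : IsOfIsotropicType F) (A : C)
    (u u' : Aut A) (hu : u ∈ unitsSubgroup F A) (hu' : u' ∈ unitsSubgroup F A) : u * u' = u' * u := by
  have h := endSubmonoid_comm_of_isOfIsotropicType hF hiso A u.hom u'.hom ⟨hu.1, hu.2⟩ ⟨hu'.1, hu'.2⟩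
  apply Iso.ext
  change u'.hom ≫ u.hom = u.hom ≫ u'.hom
  exact h.symm

/-! ### The group-theoretic core of the transfer -/

/-- Along a group homomorphism `π : G₁ → G₂` carrying the subgroup `U₁ ≤ G₁` ONTO the subgroup
`U₂ ≤ G₂`: if `U₂` has a non-torsion element and every `f ∈ G₂` acting (by conjugation) on `U₂^pf` by
some `λ = p/q ∈ ℚ_{>0}` acts trivially, then the same two properties hold for `U₁ ≤ G₁` (a non-torsion
element of `U₂` on which `π(f)` acts both by `λ` and trivially forces `λ = 1`). [cite: MochizukiFrdI2008, Def. 1.2 (iv) p.23] -/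
theorem frobeniusCompact_core {G₁ G₂ : Type*} [Group G₁] [Group G₂] (π : G₁ →* G₂)
    (U₁ : Subgroup G₁) (U₂ : Subgroup G₂)
    (hsurj : ∀ w ∈ U₂, ∃ u ∈ U₁, π u = w)
    (hnt : ∃ w ∈ U₂, ∀ N : ℕ, 0 < N → w ^ N ≠ 1)
    (hact : ∀ (f : G₂) (p q : ℕ+),
      (∀ w ∈ U₂, ∃ N : ℕ, 0 < N ∧ ((f * w * f⁻¹) ^ (q : ℕ)) ^ N = (w ^ (p : ℕ)) ^ N) →
        ∀ w ∈ U₂, ∃ N : ℕ, 0 < N ∧ (f * w * f⁻¹) ^ N = w ^ N) :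
    (∃ u ∈ U₁, ∀ N : ℕ, 0 < N → u ^ N ≠ 1) ∧
      ∀ (f : G₁) (p q : ℕ+),
        (∀ u ∈ U₁, ∃ N : ℕ, 0 < N ∧ ((f * u * f⁻¹) ^ (q : ℕ)) ^ N = (u ^ (p : ℕ)) ^ N) →
          ∀ u ∈ U₁, ∃ N : ℕ, 0 < N ∧ (f * u * f⁻¹) ^ N = u ^ N := by
  obtain ⟨w, hw, hwnt⟩ := hnt
  obtain ⟨v, hv, hπv⟩ := hsurj w hw
  refine ⟨⟨v, hv, fun N hN hvN => hwnt N hN ?_⟩, ?_⟩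
  · rw [← hπv, ← map_pow, hvN, map_one]
  intro f p q H u hu
  -- the hypothesis descends to `π f`
  have H₂ : ∀ w' ∈ U₂, ∃ N : ℕ, 0 < N ∧ ((π f * w' * (π f)⁻¹) ^ (q : ℕ)) ^ N = (w' ^ (p : ℕ)) ^ N := by
    intro w' hw'
    obtain ⟨u', hu', rfl⟩ := hsurj w' hw'
    obtain ⟨N, hN, hEq⟩ := H u' hu'
    refine ⟨N, hN, ?_⟩
    have h := congrArg π hEq
    rw [map_pow, map_pow, map_pow, map_pow, map_mul, map_mul, map_inv] at h
    exact h
  obtain ⟨N₁, hN₁, h₁⟩ := H₂ w hw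
  obtain ⟨N₂, hN₂, h₂⟩ := hact (π f) p q H₂ w hw
  -- `λ = 1`
  have e1 : (π f * w * (π f)⁻¹) ^ ((q : ℕ) * N₁ * N₂) = w ^ ((p : ℕ) * N₁ * N₂) := by
    rw [pow_mul, pow_mul, pow_mul, pow_mul, h₁]
  have e2 : (π f * w * (π f)⁻¹) ^ ((q : ℕ) * N₁ * N₂) = w ^ ((q : ℕ) * N₁ * N₂) := by
    rw [show (q : ℕ) * N₁ * N₂ = N₂ * ((q : ℕ) * N₁) from by ring, pow_mul (π f * w * (π f)⁻¹) N₂,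
      pow_mul w N₂, h₂]
  have e3 : w ^ ((p : ℕ) * N₁ * N₂) = w ^ ((q : ℕ) * N₁ * N₂) := e1.symm.trans e2
  have hpq : (p : ℕ) = q := by
    by_contra hne
    rcases Nat.lt_or_gt_of_ne hne with hlt | hgt
    · have hsplit : (q : ℕ) * N₁ * N₂ = (p : ℕ) * N₁ * N₂ + ((q : ℕ) - p) * N₁ * N₂ := by
        rw [← Nat.add_mul, ← Nat.add_mul, Nat.add_sub_cancel' hlt.le]
      have e4 : w ^ ((p : ℕ) * N₁ * N₂) * w ^ (((q : ℕ) - p) * N₁ * N₂) = w ^ ((p : ℕ) * N₁ * N₂) * 1 := by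
        rw [mul_one, ← pow_add, ← hsplit]
        exact e3.symm
      exact hwnt _ (Nat.mul_pos (Nat.mul_pos (Nat.sub_pos_of_lt hlt) hN₁) hN₂) (mul_left_cancel e4)
    · have hsplit : (p : ℕ) * N₁ * N₂ = (q : ℕ) * N₁ * N₂ + ((p : ℕ) - q) * N₁ * N₂ := by
        rw [← Nat.add_mul, ← Nat.add_mul, Nat.add_sub_cancel' hgt.le]
      have e4 : w ^ ((q : ℕ) * N₁ * N₂) * w ^ (((p : ℕ) - q) * N₁ * N₂) = w ^ ((q : ℕ) * N₁ * N₂) * 1 := by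
        rw [mul_one, ← pow_add, ← hsplit]
        exact e3
      exact hwnt _ (Nat.mul_pos (Nat.mul_pos (Nat.sub_pos_of_lt hgt) hN₁) hN₂) (mul_left_cancel e4)
  obtain ⟨N, hN, hEq⟩ := H u hu
  refine ⟨(p : ℕ) * N, Nat.mul_pos p.pos hN, ?_⟩
  rw [pow_mul, pow_mul]
  rw [← hpq] at hEq
  exact hEq

/-! ### The transfer `(C^un-tr)^birat ⇒ (C^istr)^birat` -/

namespace Birat

variable (hF : IsFrobenioid F) (hsq' : HasBiratSquares (istrFunctor F))

/-- The homomorphism `Aut((A^istr)^birat) → Aut((A^un-tr)^birat)` induced by `toUntrBirat`.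
[cite: MochizukiFrdI2008, Prop. 4.4 (i) p.83] -/
noncomputable def autMapToUntrBirat (X : Birat (istrFunctor F) (isFrobenioid_istr hF) hsq') :
    Aut X →* Aut ((toUntrBirat hF hsq').obj X) where
  toFun f := (toUntrBirat hF hsq').mapIso f
  map_one' := Iso.ext ((toUntrBirat hF hsq').map_id _)
  map_mul' _ _ := Iso.ext ((toUntrBirat hF hsq').map_comp _ _)

/-- **Transfer of Frobenius-compactness, given commutativity of `O^×((A^istr)^birat)`**: if
`(A^un-tr)^birat` is Frobenius-compact in `(C^un-tr)^birat` and `O^×((A^istr)^birat)` is commutative, then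
`(A^istr)^birat` is Frobenius-compact in `(C^istr)^birat` (the non-torsion clause and the `λ`-action
clause ascend along the surjection of units induced by the full functor `toUntrBirat`,
`frobeniusCompact_core`). [cite: MochizukiFrdI2008, Prop. 4.8 (iii) p.88] -/
theorem isFrobeniusCompact_of_toUntrBirat_of_comm
    (X : Birat (istrFunctor F) (isFrobenioid_istr hF) hsq')
    (hcomm : ∀ u ∈ unitsSubgroup (toElemZero (isFrobenioid_istr hF) hsq') X,
      ∀ u' ∈ unitsSubgroup (toElemZero (isFrobenioid_istr hF) hsq') X, u * u' = u' * u)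
    (h : (ofFunctor (zeroMonoid D) (toElemZero (isFrobenioid_untr hF) (hasBiratSquares_untr hF))).IsFrobeniusCompact
      ((toUntrBirat hF hsq').obj X)) :
    (ofFunctor (zeroMonoid D) (toElemZero (isFrobenioid_istr hF) hsq')).IsFrobeniusCompact X := by
  unfold PreFrobenioidData.IsFrobeniusCompact at h ⊢
  simp only [PreFrobenioidData.ofFunctor_unitsSubgroup] at h ⊢
  obtain ⟨-, hnt₂, hact₂⟩ := h
  -- units go onto units
  have hsurj : ∀ w ∈ unitsSubgroup (toElemZero (isFrobenioid_untr hF) (hasBiratSquares_untr hF))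
      ((toUntrBirat hF hsq').obj X), ∃ u ∈ unitsSubgroup (toElemZero (isFrobenioid_istr hF) hsq') X,
        autMapToUntrBirat hF hsq' X u = w := by
    intro w hw
    obtain ⟨g, hg⟩ := toUntrBirat_map_surjective (hF := hF) (hsq' := hsq') (X := X) (Y := X) w.hom
    have hg' : g ∈ endSubmonoid (toElemZero (isFrobenioid_istr hF) hsq') X := by
      apply mem_endSubmonoid_of_toUntrBirat_map
      rw [show (toUntrBirat hF hsq').map g = w.hom from hg]
      exact ⟨hw.1, hw.2⟩
    have hbi : IsIso (Base (toElemZero (isFrobenioid_istr hF) hsq') g) := by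
      rw [show Base (toElemZero (isFrobenioid_istr hF) hsq') g = 𝟙 _ from hg'.1]; infer_instance
    haveI : IsIso g := Birat.isIso_of_isPreStep isOfIsotropicType_istr g ⟨hg'.2, hbi⟩
    exact ⟨asIso g, ⟨hg'.1, hg'.2⟩, Iso.ext hg⟩
  have core := frobeniusCompact_core (autMapToUntrBirat hF hsq' X)
    (unitsSubgroup (toElemZero (isFrobenioid_istr hF) hsq') X)
    (unitsSubgroup (toElemZero (isFrobenioid_untr hF) (hasBiratSquares_untr hF)) ((toUntrBirat hF hsq').obj X))
    hsurj hnt₂ hact₂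
  exact ⟨hcomm, core.1, core.2⟩

/-- **Transfer of Frobenius-compactness** (Def. 4.5 (iii)(b) ⇒ Def. 3.1 (i)(b) for `(C^istr)^birat`, the
step of Prop. 4.8 (iii), "assertion (iii) follows formally from the definitions"): if `(A^un-tr)^birat` is
Frobenius-compact in `(C^un-tr)^birat` then `(A^istr)^birat` is Frobenius-compact in `(C^istr)^birat` —
commutativity of `O^×` from isotropy, CONDITIONAL on Prop. 4.4 (ii) for `C^istr` (hypothesis `hB`); the
other two clauses by `isFrobeniusCompact_of_toUntrBirat_of_comm`. [cite: MochizukiFrdI2008, Prop. 4.8 (iii) p.88] -/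
theorem isFrobeniusCompact_of_toUntrBirat
    (hB : IsFrobenioid (toElemZero (isFrobenioid_istr hF) hsq'))
    (X : Birat (istrFunctor F) (isFrobenioid_istr hF) hsq')
    (h : (ofFunctor (zeroMonoid D) (toElemZero (isFrobenioid_untr hF) (hasBiratSquares_untr hF))).IsFrobeniusCompact
      ((toUntrBirat hF hsq').obj X)) :
    (ofFunctor (zeroMonoid D) (toElemZero (isFrobenioid_istr hF) hsq')).IsFrobeniusCompact X :=
  isFrobeniusCompact_of_toUntrBirat_of_comm hF hsq' X
    (fun u hu u' hu' => unitsSubgroup_comm_of_isOfIsotropicType hB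
      (Birat.isOfIsotropicType isOfIsotropicType_istr) X u u' hu hu') h

/-- **Def. 4.5 (iii)(b) ⇒ the residual of Prop. 4.8 (iii)**: if `(C^un-tr)^birat` admits a
Frobenius-compact object, then `(C^istr)^birat` admits one (conditional on Prop. 4.4 (ii) for `C^istr`,
hypothesis `hB`). This is the hypothesis `hb` of seat abc-iut-L6-t20's `prop48iii_of_frobeniusCompact`.
[cite: MochizukiFrdI2008, Prop. 4.8 (iii) p.88] -/
theorem exists_isFrobeniusCompact_istrBirat
    (hB : IsFrobenioid (toElemZero (isFrobenioid_istr hF) hsq'))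
    (h : ∃ Y : Birat (untrFunctor hF) (isFrobenioid_untr hF) (hasBiratSquares_untr hF),
      (ofFunctor (zeroMonoid D) (toElemZero (isFrobenioid_untr hF) (hasBiratSquares_untr hF))).IsFrobeniusCompact Y) :
    ∃ X : Birat (istrFunctor F) (isFrobenioid_istr hF) hsq',
      (ofFunctor (zeroMonoid D) (toElemZero (isFrobenioid_istr hF) hsq')).IsFrobeniusCompact X := by
  obtain ⟨Y, hY⟩ := h
  have hYiso : IsIsotropic F (Birat.out Y).as.obj :=
    (PreFrobenioidData.ofFunctor_isIsotropic F _).mp (Birat.out Y).as.property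
  refine ⟨Birat.of (istrFunctor F) (isFrobenioid_istr hF) hsq' (Istr.mk (Birat.out Y).as.obj hYiso),
    isFrobeniusCompact_of_toUntrBirat hF hsq' hB _ ?_⟩
  exact hY

/-- **Def. 4.5 (iii)(b) read at THE data** `(B, Supp, C^un-tr, (C^un-tr)^birat)` — with `SU := ` the
operations of `C^un-tr → F_Φ` and `BU := ` THE birationalization of `C^un-tr` (seat abc-iut-L6-t6's
`biratData` at `untrFunctor`) — yields the Frobenius-compact object of `(C^istr)^birat` required by
Def. 3.1 (i)(b) in Prop. 4.8 (iii) (conditional on Prop. 4.4 (ii) for `C^istr`, hypothesis `hB`).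
[cite: MochizukiFrdI2008, Prop. 4.8 (iii) p.88] -/
theorem exists_isFrobeniusCompact_istrBirat_of_rationallyStandard (hsq : HasBiratSquares F)
    (Supp : ∀ {X : D}, (ofFunctor Φ F).Mon X → Primes ((ofFunctor Φ F).Mon X) → Prop)
    (hR : (ofFunctor Φ F).IsOfRationallyStandardType
      ⟨biratData hF hsq, Supp, ofFunctor Φ (untrFunctor hF),
        biratData (isFrobenioid_untr hF) (hasBiratSquares_untr hF)⟩)
    (hB : IsFrobenioid (toElemZero (isFrobenioid_istr hF) hsq')) :
    ∃ X : Birat (istrFunctor F) (isFrobenioid_istr hF) hsq',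
      (ofFunctor (zeroMonoid D) (toElemZero (isFrobenioid_istr hF) hsq')).IsFrobeniusCompact X :=
  exists_isFrobeniusCompact_istrBirat hF hsq' hB hR.frobCompact

end Birat

end PreFrobenioid

end Literature.AlgebraicGeometry.Frobenioids
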